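import Literature.Analysis.DeBrangesSpaces.BurnolSonineSpaces
import Literature.NumberTheory.LFunctions.BurnolFourierZetaSonine
import Literature.Analysis.FunctionSpaces.L2ProductHilbertBasis
import Mathlib.MeasureTheory.Function.JacobianOneDim
import HarnessLib

/-!
# Burnol 2001 (CRAS 333), Théorème 3.1, first clause: `W_Λ ⊂ H_Λ` — the co-Poisson sums `E(φ)`,
# `φ ∈ D(𝒱_Λ)`, lie in `H_Λ` (PROVED)

LINE 1 — LABEL: RH-FREE (`L²` bookkeeping: the Müntz–Poisson sums `E(φ)(u) = Σ_{n≥1} φ(nu) − φ̂(1)/u`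
of test functions supported in `[1/Λ, Λ]` with `φ̂(0) = φ̂(1) = 0`, and their inversion
`I E(φ) = P'(Iφ)`, a co-Poisson sum; the Riemann zeta function does not occur). FRAMING (cell rh-crit,
D-0074): corpus theorems are RH-FREE literature; nothing here is worded as progress toward RH.
bears_on: B-C/B-P (LADDER-RH COLUMN 6, de Branges framework). WHAT THIS IS NOT: not a route, not an RH
criterion; nothing here bears on the truth of RH.

Source: J.-F. Burnol, *Sur certains espaces de Hilbert de fonctions entières, liés à la transformation de
Fourier et aux fonctions L de Dirichlet et de Riemann*, C. R. Acad. Sci. Paris Sér. I **333** (2001)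
201–206 = arXiv:math/0105120 [Burnol2001CRAS], §3, Théorème 3.1 (TeX of record
`dbl/src/Burnol2001CRAS_arXivmath0105120.tex` l.522–526), first assertion: *Soit `Λ > 1`. On a
`W_Λ ⊂ H_Λ`*, typed in `BurnolSonineSpaces.lean` inside the named fact `Burnol2001.Burnol2001CRAS_thm3_1`
over `Burnol2001.crasW` (`W_Λ` = closure of the classes of `E(φ)`, `φ ∈ D(𝒱_Λ)`) and
`Burnol2001.memHLambda` (`H_Λ = I K_{1/Λ}`). Printed proof (TeX l.528–533): "la fonction `E(φ)(u)`
appartient à `K` … La formule de co-Poisson (formule de Poisson pour `I(E(φ))`) montre `E(φ) ∈ H_Λ`".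

## What is PROVED (theorem-only module: no definition, no named fact)

* Transport lemmas for the unitary involution `I f(t) = f(1/t)/|t|` of `L²(ℝ)` (public versions of
  the private lemmas of `BurnolHLambdaDensityProofs.lean`, same proofs): `Burnol2001.quasiMeasurePreserving_invReal`,
  `Burnol2001.memLp_invT`, `Burnol2001.norm_toLp_invT`, `Burnol2001.toLp_invT_invT`,
  `Burnol2001.memHLambda_toLp_invT_of_mem_sonineK` (`I K_λ ⊆ H_{1/λ}`).
* `Burnol2001.memHLambda_iff_invT`, `Burnol2001.isClosed_setOf_memHLambda` — `H_Λ` is closed in `L²(ℝ)`.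
* `Burnol2001.isTestAway_inv_abs` — for `φ ∈ 𝒱_Λ`, `α(y) = φ(1/|y|)/|y| = I(φ ∘ |·|)(y)` is a
  Burnol 2004 test function (smooth, even, compact support away from `0`), and its two moments are
  `∫₀^∞ α = ∫₀^∞ φ(t)dt/t = φ̂(0)`, `∫₀^∞ α(u)du/u = ∫₀^∞ φ = φ̂(1)`.
* `Burnol2001.coSum_inv_abs_div_eq_poissonE` — the co-Poisson identity `I(P'(α)) = E(φ)` pointwise off `0`
  (for `∫₀^∞ φ = 0`), `P'` = `Literature.NumberTheory.LFunctions.CoPoisson.coSum` (Burnol 2004, `P' = I P I`).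
* `Burnol2001.exists_memHLambda_ae_eq_poissonE` — for `φ ∈ D(𝒱_Λ)` the class of `E(φ)` exists in `L²`
  and lies in `H_Λ`: `I E(φ) = P'(α) ∈ K_{1/Λ}` by the tree theorem
  `Literature.NumberTheory.LFunctions.CoPoisson.IsTestAway.toLp_coSum_mem_sonineK` (Burnol 2004 §6:
  co-Poisson sums with two vanishing moments are Sonine functions), then `H_Λ = I K_{1/Λ}`.
* **`Burnol2001.crasW_subset_memHLambda`** — `W_Λ ⊆ H_Λ` for every `Λ > 0` (the first clause of
  Théorème 3.1; for `Λ ≤ 1` both `D(𝒱_Λ)` and the statement are trivial).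

## References
* [Burnol2001CRAS] C. R. Acad. Sci. Paris Sér. I 333 (2001) 201–206, §3, Thm. 3.1 (TeX l.522–533),
  §2 (TeX l.410–418: `H_Λ = I K_{1/Λ}`), §1 (TeX l.302: `I` unitary).
* [Burnol2004] Forum Math. 16 (2004) 789–840, §4 (`P' = I P I`, Thm. 4.4) and §6 opening
  (co-Poisson examples of Sonine functions) — tree theorems `Burnol2004_thm_4_4_holds`,
  `CoPoisson.IsTestAway.toLp_coSum_mem_sonineK`.
-/

noncomputable section

open _root_.MeasureTheory _root_.Set _root_.Filter FourierTransform
open scoped Topology ENNReal ContDiff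
open Literature.NumberTheory.LFunctions Literature.Analysis.FunctionSpaces

namespace Literature.Analysis.DeBrangesSpaces

namespace Burnol2001

section InversionTransport

/-! ### The inversion `t ↦ 1/t` on `(ℝ, dt)` and the `L²` isometry `f ↦ f(1/t)/|t|`
(public versions of the transport lemmas of `BurnolHLambdaDensityProofs.lean`) -/

/-- `t ↦ t⁻¹` is quasi-measure-preserving for Lebesgue measure (off `0` the map is differentiable, so it
sends null sets to null sets) — the measure-theoretic content of "`I` est unitaire", used to transport
a.e. statements along `I`. [cite: Burnol2001CRAS, §1 (TeX l.302)] -/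
theorem quasiMeasurePreserving_invReal :
    Measure.QuasiMeasurePreserving (fun t : ℝ ↦ t⁻¹) volume volume := by
  refine ⟨measurable_inv, Measure.AbsolutelyContinuous.mk fun N hN hN0 ↦ ?_⟩
  rw [Measure.map_apply measurable_inv hN]
  have hsub : (fun t : ℝ ↦ t⁻¹) ⁻¹' N ⊆ (fun t : ℝ ↦ t⁻¹) '' (N \ {0}) ∪ {0} := by
    intro t ht
    by_cases ht0 : t = 0
    · exact Or.inr ht0
    · exact Or.inl ⟨t⁻¹, ⟨ht, inv_ne_zero ht0⟩, inv_inv t⟩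
  have hdiff : DifferentiableOn ℝ (fun t : ℝ ↦ t⁻¹) (N \ {0}) :=
    fun t ht ↦ (hasDerivAt_inv ht.2).differentiableAt.differentiableWithinAt
  have h1 : volume ((fun t : ℝ ↦ t⁻¹) '' (N \ {0})) = 0 :=
    addHaar_image_eq_zero_of_differentiableOn_of_addHaar_eq_zero volume hdiff
      (measure_mono_null (fun x hx ↦ hx.1) hN0)
  exact measure_mono_null hsub (measure_union_null h1 (measure_singleton 0))

/-- Almost every real number is non-zero. [folklore] -/
private theorem ae_ne_zero_real : ∀ᵐ t : ℝ, t ≠ 0 := by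
  have : ({0}ᶜ : Set ℝ) ∈ ae (volume : Measure ℝ) := compl_mem_ae_iff.2 (measure_singleton 0)
  filter_upwards [this] with t ht
  exact ht

/-- `ℝ ∖ {0}` has full measure. [folklore] -/
private theorem compl_zero_ae_eq_univ' : (({0}ᶜ : Set ℝ)) =ᵐ[volume] (univ : Set ℝ) :=
  ae_eq_univ.2 (by rw [compl_compl]; exact measure_singleton (0 : ℝ))

/-- The image of `ℝ ∖ {0}` under `t ↦ t⁻¹` is `ℝ ∖ {0}`. [folklore] -/
private theorem image_inv_compl_zero' :
    (fun t : ℝ ↦ t⁻¹) '' ({0}ᶜ : Set ℝ) = ({0}ᶜ : Set ℝ) := by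
  ext x
  simp only [mem_image, mem_compl_iff, mem_singleton_iff]
  constructor
  · rintro ⟨t, ht, rfl⟩
    exact inv_ne_zero ht
  · intro hx
    exact ⟨x⁻¹, inv_ne_zero hx, inv_inv x⟩

/-- The pointwise identity `‖k(t⁻¹)/|t|‖² = |−(t²)⁻¹| · ‖k(t⁻¹)‖²`. [folklore] -/
private theorem norm_sq_invT_eq' (k : ℝ → ℂ) (t : ℝ) :
    ‖k t⁻¹ / ((|t| : ℝ) : ℂ)‖ ^ 2 = |(-(t ^ 2)⁻¹ : ℝ)| • ‖k t⁻¹‖ ^ 2 := by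
  rw [norm_div, Complex.norm_real, Real.norm_eq_abs, abs_abs, div_pow, abs_neg, abs_inv, abs_pow,
    sq_abs, smul_eq_mul]
  ring

/-- **The inversion `k ↦ k(1/t)/|t|` preserves `L²(ℝ)`** (change of variables `u = 1/t`, Jacobian `t⁻²`).
[cite: Burnol2001CRAS, §1 (TeX l.302: "`I` est unitaire")] -/
theorem memLp_invT (k : Lp ℂ 2 (volume : Measure ℝ)) :
    MemLp (fun t : ℝ ↦ (k : ℝ → ℂ) t⁻¹ / ((|t| : ℝ) : ℂ)) 2 volume := by
  have hmeas : AEStronglyMeasurable (fun t : ℝ ↦ (k : ℝ → ℂ) t⁻¹ / ((|t| : ℝ) : ℂ)) volume := by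
    have h1 : AEStronglyMeasurable (fun t : ℝ ↦ (k : ℝ → ℂ) t⁻¹) volume :=
      (Lp.aestronglyMeasurable k).comp_quasiMeasurePreserving quasiMeasurePreserving_invReal
    have h2 : AEStronglyMeasurable (fun t : ℝ ↦ (((|t| : ℝ) : ℂ))⁻¹) volume :=
      (Complex.continuous_ofReal.measurable.comp measurable_abs).inv.aestronglyMeasurable
    exact (h1.mul h2).congr (Eventually.of_forall fun t ↦ (div_eq_mul_inv _ _).symm)
  rw [memLp_two_iff_integrable_sq_norm hmeas]
  have hG : Integrable (fun x : ℝ ↦ ‖(k : ℝ → ℂ) x‖ ^ 2) volume := integrable_sq_norm_Lp k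
  have hderiv : ∀ t ∈ ({0}ᶜ : Set ℝ), HasDerivWithinAt (fun t : ℝ ↦ t⁻¹) (-(t ^ 2)⁻¹) ({0}ᶜ : Set ℝ) t :=
    fun t ht ↦ (hasDerivAt_inv ht).hasDerivWithinAt
  have hinj : InjOn (fun t : ℝ ↦ t⁻¹) ({0}ᶜ : Set ℝ) := inv_injective.injOn
  have hOn : IntegrableOn (fun t : ℝ ↦ |(-(t ^ 2)⁻¹ : ℝ)| • ‖(k : ℝ → ℂ) t⁻¹‖ ^ 2) ({0}ᶜ : Set ℝ) := by
    rw [← integrableOn_image_iff_integrableOn_abs_deriv_smul (measurableSet_singleton 0).compl hderiv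
      hinj (fun x : ℝ ↦ ‖(k : ℝ → ℂ) x‖ ^ 2), image_inv_compl_zero']
    exact hG.integrableOn
  have hOn' : IntegrableOn (fun t : ℝ ↦ ‖(k : ℝ → ℂ) t⁻¹ / ((|t| : ℝ) : ℂ)‖ ^ 2) ({0}ᶜ : Set ℝ) :=
    hOn.congr_fun (fun t _ ↦ (norm_sq_invT_eq' _ t).symm) (measurableSet_singleton 0).compl
  have huniv : IntegrableOn (fun t : ℝ ↦ ‖(k : ℝ → ℂ) t⁻¹ / ((|t| : ℝ) : ℂ)‖ ^ 2) (univ : Set ℝ) :=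
    hOn'.congr_set_ae compl_zero_ae_eq_univ'.symm
  exact integrableOn_univ.1 huniv

/-- **`I` is an isometry of `L²(ℝ)`**: `∫ |k(1/t)|²/t² dt = ∫ |k(u)|² du`.
[cite: Burnol2001CRAS, §1 (TeX l.302: "`I` est unitaire")] -/
theorem norm_toLp_invT (k : Lp ℂ 2 (volume : Measure ℝ)) :
    ‖(memLp_invT k).toLp (fun t : ℝ ↦ (k : ℝ → ℂ) t⁻¹ / ((|t| : ℝ) : ℂ))‖ = ‖k‖ := by
  have hsq : ‖(memLp_invT k).toLp (fun t : ℝ ↦ (k : ℝ → ℂ) t⁻¹ / ((|t| : ℝ) : ℂ))‖ ^ 2 = ‖k‖ ^ 2 := by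
    rw [norm_sq_eq_integral_Lp_two, norm_sq_eq_integral_Lp_two]
    have hae := (memLp_invT k).coeFn_toLp
    calc ∫ t, ‖((memLp_invT k).toLp (fun t : ℝ ↦ (k : ℝ → ℂ) t⁻¹ / ((|t| : ℝ) : ℂ)) : ℝ → ℂ) t‖ ^ 2
        = ∫ t, ‖(k : ℝ → ℂ) t⁻¹ / ((|t| : ℝ) : ℂ)‖ ^ 2 := by
          refine integral_congr_ae ?_
          filter_upwards [hae] with t ht
          rw [ht]
      _ = ∫ t in ({0}ᶜ : Set ℝ), ‖(k : ℝ → ℂ) t⁻¹ / ((|t| : ℝ) : ℂ)‖ ^ 2 := by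
          rw [← setIntegral_univ]
          exact setIntegral_congr_set compl_zero_ae_eq_univ'.symm
      _ = ∫ t in ({0}ᶜ : Set ℝ), |(-(t ^ 2)⁻¹ : ℝ)| • ‖(k : ℝ → ℂ) t⁻¹‖ ^ 2 := by
          refine setIntegral_congr_fun (measurableSet_singleton 0).compl fun t _ ↦ ?_
          exact norm_sq_invT_eq' _ t
      _ = ∫ x in (fun t : ℝ ↦ t⁻¹) '' ({0}ᶜ : Set ℝ), ‖(k : ℝ → ℂ) x‖ ^ 2 :=
          (integral_image_eq_integral_abs_deriv_smul (measurableSet_singleton 0).compl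
            (fun t ht ↦ (hasDerivAt_inv ht).hasDerivWithinAt) inv_injective.injOn
            (fun x : ℝ ↦ ‖(k : ℝ → ℂ) x‖ ^ 2)).symm
      _ = ∫ x, ‖(k : ℝ → ℂ) x‖ ^ 2 := by
          rw [image_inv_compl_zero']
          exact (setIntegral_congr_set (f := fun x : ℝ ↦ ‖(k : ℝ → ℂ) x‖ ^ 2)
            compl_zero_ae_eq_univ').trans setIntegral_univ
  have h1 : 0 ≤ ‖(memLp_invT k).toLp (fun t : ℝ ↦ (k : ℝ → ℂ) t⁻¹ / ((|t| : ℝ) : ℂ))‖ := norm_nonneg _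
  have h2 : 0 ≤ ‖k‖ := norm_nonneg _
  nlinarith [hsq, h1, h2, sq_nonneg (‖(memLp_invT k).toLp (fun t : ℝ ↦ (k : ℝ → ℂ) t⁻¹ /
    ((|t| : ℝ) : ℂ))‖ - ‖k‖)]

/-- **`I` is an involution** (a.e. form, the shape of the `g`-clause of `memHLambda`): with `f = Ik`,
`k(t) = f(t⁻¹)/|t|` for a.e. `t`. [cite: Burnol2001CRAS, §1–2 (TeX l.302, 410–418)] -/
theorem ae_invT_invT (k : Lp ℂ 2 (volume : Measure ℝ)) :
    ∀ᵐ t : ℝ, (k : ℝ → ℂ) t =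
      ((memLp_invT k).toLp (fun t : ℝ ↦ (k : ℝ → ℂ) t⁻¹ / ((|t| : ℝ) : ℂ)) : ℝ → ℂ) t⁻¹ /
        ((|t| : ℝ) : ℂ) := by
  have hae := (memLp_invT k).coeFn_toLp
  have hae' := quasiMeasurePreserving_invReal.ae hae
  filter_upwards [hae', ae_ne_zero_real] with t ht ht0
  rw [ht, inv_inv, abs_inv]
  have h : ((|t| : ℝ) : ℂ) ≠ 0 := by exact_mod_cast (abs_pos.2 ht0).ne'
  push_cast
  field_simp

/-- The involution at the level of `L²` classes: `I(Ik) = k`. [cite: Burnol2001CRAS, §1 (TeX l.302)] -/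
theorem toLp_invT_invT (k : Lp ℂ 2 (volume : Measure ℝ)) :
    (memLp_invT ((memLp_invT k).toLp (fun t : ℝ ↦ (k : ℝ → ℂ) t⁻¹ / ((|t| : ℝ) : ℂ)))).toLp
      (fun t : ℝ ↦ ((memLp_invT k).toLp (fun t : ℝ ↦ (k : ℝ → ℂ) t⁻¹ / ((|t| : ℝ) : ℂ)) : ℝ → ℂ) t⁻¹ /
        ((|t| : ℝ) : ℂ)) = k := by
  apply Lp.ext
  filter_upwards [MemLp.coeFn_toLp (memLp_invT ((memLp_invT k).toLp
    (fun t : ℝ ↦ (k : ℝ → ℂ) t⁻¹ / ((|t| : ℝ) : ℂ)))), ae_invT_invT k] with t ht ht'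
  rw [ht, ← ht']

/-- If `g = f(1/t)/|t|` a.e. then the class `g` is `I f`. [cite: Burnol2001CRAS, §1 (TeX l.302)] -/
theorem eq_toLp_invT_of_ae_eq {f g : Lp ℂ 2 (volume : Measure ℝ)}
    (hg : ∀ᵐ t : ℝ, (g : ℝ → ℂ) t = (f : ℝ → ℂ) t⁻¹ / ((|t| : ℝ) : ℂ)) :
    g = (memLp_invT f).toLp (fun t : ℝ ↦ (f : ℝ → ℂ) t⁻¹ / ((|t| : ℝ) : ℂ)) := by
  apply Lp.ext
  filter_upwards [hg, (memLp_invT f).coeFn_toLp] with t h1 h2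
  rw [h1, h2]

/-- `I` is additive: it commutes with subtraction (a.e. pointwise, hence in `L²`; part of "`I` est
unitaire"). [cite: Burnol2001CRAS, §1 (TeX l.302)] -/
theorem toLp_invT_sub (k h : Lp ℂ 2 (volume : Measure ℝ)) :
    (memLp_invT (k - h)).toLp (fun t : ℝ ↦ ((k - h : Lp ℂ 2 (volume : Measure ℝ)) : ℝ → ℂ) t⁻¹ /
        ((|t| : ℝ) : ℂ)) =
      (memLp_invT k).toLp (fun t : ℝ ↦ (k : ℝ → ℂ) t⁻¹ / ((|t| : ℝ) : ℂ)) -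
        (memLp_invT h).toLp (fun t : ℝ ↦ (h : ℝ → ℂ) t⁻¹ / ((|t| : ℝ) : ℂ)) := by
  apply Lp.ext
  have hsub := quasiMeasurePreserving_invReal.ae (Lp.coeFn_sub k h)
  filter_upwards [(memLp_invT (k - h)).coeFn_toLp, hsub,
    Lp.coeFn_sub ((memLp_invT k).toLp (fun t : ℝ ↦ (k : ℝ → ℂ) t⁻¹ / ((|t| : ℝ) : ℂ)))
      ((memLp_invT h).toLp (fun t : ℝ ↦ (h : ℝ → ℂ) t⁻¹ / ((|t| : ℝ) : ℂ))),
    (memLp_invT k).coeFn_toLp, (memLp_invT h).coeFn_toLp] with t h1 h2 h3 h4 h5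
  rw [h1, h3, Pi.sub_apply, h4, h5, h2, Pi.sub_apply, sub_div]

/-- `‖Ik − Ih‖ = ‖k − h‖`. [cite: Burnol2001CRAS, §1 (TeX l.302: "`I` est unitaire")] -/
theorem norm_toLp_invT_sub (k h : Lp ℂ 2 (volume : Measure ℝ)) :
    ‖(memLp_invT k).toLp (fun t : ℝ ↦ (k : ℝ → ℂ) t⁻¹ / ((|t| : ℝ) : ℂ)) -
        (memLp_invT h).toLp (fun t : ℝ ↦ (h : ℝ → ℂ) t⁻¹ / ((|t| : ℝ) : ℂ))‖ = ‖k - h‖ := by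
  rw [← toLp_invT_sub, norm_toLp_invT]

/-- `I : L²(ℝ) → L²(ℝ)` is continuous (it is an isometry). [cite: Burnol2001CRAS, §1 (TeX l.302)] -/
theorem continuous_toLp_invT :
    Continuous (fun k : Lp ℂ 2 (volume : Measure ℝ) ↦
      (memLp_invT k).toLp (fun t : ℝ ↦ (k : ℝ → ℂ) t⁻¹ / ((|t| : ℝ) : ℂ))) := by
  refine (Isometry.of_dist_eq fun k h ↦ ?_).continuous
  rw [dist_eq_norm, dist_eq_norm, norm_toLp_invT_sub]

/-- `I` preserves evenness (it acts on `K`, the even classes: "`I(f)(t) = f(1/t)/t`, qui est unitaire",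
TeX l.302, and `H_Λ = I K_{λ,λ} ⊂ K`, TeX l.418). [cite: Burnol2001CRAS, §1–2 (TeX l.302, 418)] -/
theorem toLp_invT_mem_evenL2 {k : Lp ℂ 2 (volume : Measure ℝ)} (hk : k ∈ evenL2) :
    (memLp_invT k).toLp (fun t : ℝ ↦ (k : ℝ → ℂ) t⁻¹ / ((|t| : ℝ) : ℂ)) ∈ evenL2 := by
  have hk' : ∀ᵐ u : ℝ, (k : ℝ → ℂ) (-u) = (k : ℝ → ℂ) u := hk
  have hneg : Measure.QuasiMeasurePreserving (fun x : ℝ ↦ -x) volume volume :=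
    (Measure.measurePreserving_neg (volume : Measure ℝ)).quasiMeasurePreserving
  have hae := (memLp_invT k).coeFn_toLp
  have hae' := hneg.ae hae
  have hk'' := quasiMeasurePreserving_invReal.ae hk'
  simp only [evenL2, Set.mem_setOf_eq]
  filter_upwards [hae, hae', hk''] with t h1 h2 h3
  rw [h2, h1, inv_neg, h3, abs_neg]

/-- **`I` maps `K_λ` into `H_{1/λ}`** ("`H_Λ = I K_{λ,λ}` avec `λ = 1/Λ`"): for `k ∈ K_λ`, `λ > 0`, the class
`Ik` of `t ↦ k(t⁻¹)/|t|` satisfies `memHLambda λ⁻¹`, with witness `g = k` for the `𝒢`-clause.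
[cite: Burnol2001CRAS, §2 (TeX l.410–418)] -/
theorem memHLambda_toLp_invT_of_mem_sonineK {lam : ℝ} (hlam : 0 < lam)
    {k : Lp ℂ 2 (volume : Measure ℝ)} (hk : k ∈ sonineK lam) :
    memHLambda lam⁻¹ ((memLp_invT k).toLp (fun t : ℝ ↦ (k : ℝ → ℂ) t⁻¹ / ((|t| : ℝ) : ℂ))) := by
  obtain ⟨hke, hk0, hk1⟩ := hk
  have hke' : ∀ᵐ u : ℝ, (k : ℝ → ℂ) (-u) = (k : ℝ → ℂ) u := hke
  have hneg : Measure.QuasiMeasurePreserving (fun x : ℝ ↦ -x) volume volume :=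
    (Measure.measurePreserving_neg (volume : Measure ℝ)).quasiMeasurePreserving
  -- `k = 0` a.e. on `|u| < λ` (two-sided, from evenness)
  have hk0' : ∀ᵐ u : ℝ, |u| < lam → u ≠ 0 → (k : ℝ → ℂ) u = 0 := by
    have h := hneg.ae hk0
    filter_upwards [hk0, h, hke'] with u h1 h2 h3 hu hu0
    rcases lt_or_gt_of_ne hu0 with hneg' | hpos
    · rw [← h3]
      exact h2 ⟨by linarith, by rw [abs_of_neg hneg'] at hu; linarith⟩
    · exact h1 ⟨hpos, by rwa [abs_of_pos hpos] at hu⟩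
  have hae := (memLp_invT k).coeFn_toLp
  refine ⟨toLp_invT_mem_evenL2 hke, ?_, ⟨k, ae_invT_invT k, ?_⟩⟩
  · -- vanishing for `|t| > 1/λ`
    have h := quasiMeasurePreserving_invReal.ae hk0'
    filter_upwards [hae, h] with t h1 h2 ht
    have ht0 : t ≠ 0 := by
      rintro rfl
      rw [abs_zero] at ht
      exact absurd ht (not_lt.2 (inv_pos.2 hlam).le)
    have hlt : |t⁻¹| < lam := by
      rw [abs_inv]
      calc |t|⁻¹ < lam⁻¹⁻¹ := by
            apply inv_strictAnti₀ (inv_pos.2 hlam) ht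
        _ = lam := inv_inv lam
    rw [h1, h2 hlt (inv_ne_zero ht0), zero_div]
  · -- the cosine transform of `g = k` vanishes on `|t| < (1/λ)⁻¹ = λ`
    rw [inv_inv]
    have hFe : ∀ᵐ u : ℝ, ((𝓕 k : Lp ℂ 2 (volume : Measure ℝ)) : ℝ → ℂ) (-u) =
        ((𝓕 k : Lp ℂ 2 (volume : Measure ℝ)) : ℝ → ℂ) u := fourier_mem_evenL2 hke
    have h := hneg.ae hk1
    filter_upwards [hk1, h, hFe, ae_ne_zero_real] with u h1 h2 h3 hu0 hu
    rcases lt_or_gt_of_ne hu0 with hneg' | hpos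
    · rw [← h3]
      exact h2 ⟨by linarith, by rw [abs_of_neg hneg'] at hu; linarith⟩
    · exact h1 ⟨hpos, by rwa [abs_of_pos hpos] at hu⟩

/-! ### `H_Λ` is closed -/

/-- `L²`-limits preserve "a.e. zero on `S`". [folklore] -/
private theorem isClosed_setOf_ae_eq_zero_on (S : Set ℝ) :
    IsClosed {f : Lp ℂ 2 (volume : Measure ℝ) | ∀ᵐ x : ℝ, x ∈ S → f x = 0} := by
  refine IsSeqClosed.isClosed fun u f hu huf => ?_
  obtain ⟨ns, -, hns⟩ := (tendstoInMeasure_of_tendsto_Lp huf).exists_seq_tendsto_ae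
  have hall : ∀ᵐ x : ℝ, ∀ i, x ∈ S → u (ns i) x = 0 := ae_all_iff.2 fun i => hu (ns i)
  filter_upwards [hns, hall] with x hx hx' hxS
  exact tendsto_nhds_unique hx (tendsto_const_nhds.congr fun i => (hx' i hxS).symm)

/-- `H_Λ` rewritten with the CANONICAL witness `g = I f` of its `𝒢`-clause: `memHLambda Λ f` iff `f` is
even, a.e. zero on `|t| > Λ`, and the cosine transform of the class `I f` is a.e. zero on `|t| < 1/Λ`.
[cite: Burnol2001CRAS, §2 (TeX l.410–418)] -/
theorem memHLambda_iff_invT {Λ : ℝ} {f : Lp ℂ 2 (volume : Measure ℝ)} :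
    memHLambda Λ f ↔
      f ∈ evenL2 ∧ (∀ᵐ t : ℝ, Λ < |t| → f t = 0) ∧
        ∀ᵐ t : ℝ, |t| < Λ⁻¹ →
          (𝓕 ((memLp_invT f).toLp (fun t : ℝ ↦ (f : ℝ → ℂ) t⁻¹ / ((|t| : ℝ) : ℂ))) :
            Lp ℂ 2 (volume : Measure ℝ)) t = 0 := by
  constructor
  · rintro ⟨he, hz, g, hg, hFg⟩
    refine ⟨he, hz, ?_⟩
    rw [← eq_toLp_invT_of_ae_eq hg]
    exact hFg
  · rintro ⟨he, hz, hF⟩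
    exact ⟨he, hz, _, (memLp_invT f).coeFn_toLp, hF⟩

/-- **`H_Λ` is a closed subspace-as-set of `L²(ℝ)`** (intersection of three closed conditions, the third
through the continuity of `I` and of the `L²` Fourier transform). [cite: Burnol2001CRAS, §2 (TeX l.410–425)] -/
theorem isClosed_setOf_memHLambda (Λ : ℝ) :
    IsClosed {f : Lp ℂ 2 (volume : Measure ℝ) | memHLambda Λ f} := by
  have hF : IsClosed ((fun f : Lp ℂ 2 (volume : Measure ℝ) =>
      (𝓕 ((memLp_invT f).toLp (fun t : ℝ ↦ (f : ℝ → ℂ) t⁻¹ / ((|t| : ℝ) : ℂ))) :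
        Lp ℂ 2 (volume : Measure ℝ))) ⁻¹'
      {g : Lp ℂ 2 (volume : Measure ℝ) | ∀ᵐ x : ℝ, x ∈ {t : ℝ | |t| < Λ⁻¹} → g x = 0}) :=
    (isClosed_setOf_ae_eq_zero_on _).preimage (continuous_fourier.comp continuous_toLp_invT)
  have h : {f : Lp ℂ 2 (volume : Measure ℝ) | memHLambda Λ f} =
      evenL2 ∩ {f : Lp ℂ 2 (volume : Measure ℝ) | ∀ᵐ x : ℝ, x ∈ {t : ℝ | Λ < |t|} → f x = 0} ∩
      ((fun f : Lp ℂ 2 (volume : Measure ℝ) =>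
        (𝓕 ((memLp_invT f).toLp (fun t : ℝ ↦ (f : ℝ → ℂ) t⁻¹ / ((|t| : ℝ) : ℂ))) :
          Lp ℂ 2 (volume : Measure ℝ))) ⁻¹'
        {g : Lp ℂ 2 (volume : Measure ℝ) | ∀ᵐ x : ℝ, x ∈ {t : ℝ | |t| < Λ⁻¹} → g x = 0}) := by
    ext f
    simp only [Set.mem_setOf_eq, Set.mem_inter_iff, Set.mem_preimage, memHLambda_iff_invT]
    tauto
  rw [h]
  exact (isClosed_evenL2.inter (isClosed_setOf_ae_eq_zero_on _)).inter hF

end InversionTransport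

section CoPoisson

/-! ### The test function `α = I(φ ∘ |·|)` of a `φ ∈ 𝒱_Λ` and the co-Poisson identity `I(P'(α)) = E(φ)` -/

variable {Λ : ℝ} {φ : ℝ → ℂ}

/-- For `φ ∈ 𝒱_Λ` ("supportées par `[1/Λ, Λ]`"), `φ(t) = 0` for `t < 1/Λ`.
[cite: Burnol2001CRAS, §3 (TeX l.503–505)] -/
theorem MemVLambda.eq_zero_of_lt (hφ : MemVLambda Λ φ) {t : ℝ} (ht : t < Λ⁻¹) : φ t = 0 := by
  by_contra h
  exact absurd (hφ.2 (Function.mem_support.2 h)).1 (not_le.2 ht)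

/-- For `φ ∈ 𝒱_Λ` ("supportées par `[1/Λ, Λ]`"), `φ(t) = 0` for `t > Λ`.
[cite: Burnol2001CRAS, §3 (TeX l.503–505)] -/
theorem MemVLambda.eq_zero_of_gt (hφ : MemVLambda Λ φ) {t : ℝ} (ht : Λ < t) : φ t = 0 := by
  by_contra h
  exact absurd (hφ.2 (Function.mem_support.2 h)).2 (not_le.2 ht)

/-- For `φ ∈ 𝒱_Λ` and `Λ > 0`, the function `α(y) = φ(1/|y|)/|y|` vanishes for `|y| < 1/Λ`.
[cite: Burnol2001CRAS, §3 (TeX l.503–511)] -/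
theorem inv_abs_eq_zero_of_abs_lt (hΛ : 0 < Λ) (hφ : MemVLambda Λ φ) {y : ℝ} (hy : |y| < Λ⁻¹) :
    CoPoisson.inv (fun u : ℝ ↦ φ |u|) y = 0 := by
  simp only [CoPoisson.inv]
  by_cases hy0 : y = 0
  · subst hy0
    simp only [inv_zero, abs_zero]
    rw [hφ.eq_zero_of_lt (inv_pos.2 hΛ), zero_div]
  · have hpos : 0 < |y| := abs_pos.2 hy0
    have : Λ < |y⁻¹| := by
      rw [abs_inv]
      calc Λ = Λ⁻¹⁻¹ := (inv_inv Λ).symm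
        _ < |y|⁻¹ := inv_strictAnti₀ hpos hy
    rw [hφ.eq_zero_of_gt this, zero_div]

/-- For `φ ∈ 𝒱_Λ` and `Λ > 0`, `α(y) = φ(1/|y|)/|y|` vanishes for `|y| > Λ = (1/Λ)⁻¹`.
[cite: Burnol2001CRAS, §3 (TeX l.503–511)] -/
theorem inv_abs_eq_zero_of_lt_abs (hΛ : 0 < Λ) (hφ : MemVLambda Λ φ) {y : ℝ} (hy : Λ⁻¹⁻¹ < |y|) :
    CoPoisson.inv (fun u : ℝ ↦ φ |u|) y = 0 := by
  simp only [CoPoisson.inv]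
  rw [inv_inv] at hy
  have hpos : 0 < |y| := hΛ.trans hy
  have : |y⁻¹| < Λ⁻¹ := by
    rw [abs_inv]
    exact inv_strictAnti₀ hΛ hy
  rw [hφ.eq_zero_of_lt this, zero_div]

/-- **`α = I(φ ∘ |·|)` is a Burnol-2004 test function** for `φ ∈ 𝒱_Λ`, `Λ > 0`: smooth (a composition of
smooth maps off `0`, identically `0` on `|y| < 1/Λ`), even, with compact support inside `1/Λ ≤ |y| ≤ Λ`.
[cite: Burnol2001CRAS, §3 (TeX l.503–533); Burnol2004, Thm 4.4 (TeX l.1288)] -/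
theorem isTestAway_inv_abs (hΛ : 0 < Λ) (hφ : MemVLambda Λ φ) :
    CoPoisson.IsTestAway (CoPoisson.inv (fun u : ℝ ↦ φ |u|)) := by
  have hzero : ∀ y : ℝ, |y| < Λ⁻¹ → CoPoisson.inv (fun u : ℝ ↦ φ |u|) y = 0 :=
    fun y hy ↦ inv_abs_eq_zero_of_abs_lt hΛ hφ hy
  have hev0 : CoPoisson.inv (fun u : ℝ ↦ φ |u|) =ᶠ[𝓝 0] 0 := by
    have : Metric.ball (0 : ℝ) Λ⁻¹ ∈ 𝓝 (0 : ℝ) := Metric.ball_mem_nhds 0 (inv_pos.2 hΛ)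
    filter_upwards [this] with y hy
    rw [Metric.mem_ball, dist_zero_right, Real.norm_eq_abs] at hy
    exact hzero y hy
  refine ⟨?_, ?_, ?_, ?_⟩
  · -- smoothness
    rw [contDiff_iff_contDiffAt]
    intro y
    by_cases hy0 : y = 0
    · subst hy0
      exact (contDiffAt_const (c := (0 : ℂ))).congr_of_eventuallyEq hev0
    · have habs : ContDiffAt ℝ ∞ (fun u : ℝ ↦ |u|) y := contDiffAt_abs hy0
      have hinv : ContDiffAt ℝ ∞ (fun u : ℝ ↦ |u|⁻¹) y := habs.inv (abs_pos.2 hy0).ne'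
      have h1 : ContDiffAt ℝ ∞ (fun u : ℝ ↦ φ |u|⁻¹) y := (hφ.1.contDiffAt).comp y hinv
      have h2 : ContDiffAt ℝ ∞ (fun u : ℝ ↦ (((|u| : ℝ) : ℂ))⁻¹) y := by
        have hc : ContDiffAt ℝ ∞ (fun u : ℝ ↦ ((|u| : ℝ) : ℂ)) y :=
          (Complex.ofRealCLM.contDiff.contDiffAt).comp y habs
        refine hc.inv ?_
        exact_mod_cast (abs_pos.2 hy0).ne'
      have h12 := h1.mul h2
      refine h12.congr_of_eventuallyEq (Eventually.of_forall fun u ↦ ?_)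
      simp only [CoPoisson.inv, abs_inv, div_eq_mul_inv]
  · -- even
    intro y
    simp only [CoPoisson.inv, inv_neg, abs_neg]
  · -- compact support
    refine HasCompactSupport.intro (isCompact_Icc (a := -Λ⁻¹⁻¹) (b := Λ⁻¹⁻¹)) fun y hy ↦ ?_
    apply inv_abs_eq_zero_of_lt_abs hΛ hφ
    rw [mem_Icc, not_and_or, not_le, not_le] at hy
    rcases hy with h | h
    · calc Λ⁻¹⁻¹ < -y := by linarith
        _ ≤ |y| := neg_le_abs y
    · exact h.trans_le (le_abs_self y)
  · -- `0 ∉ tsupport α`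
    rw [notMem_tsupport_iff_eventuallyEq]
    exact hev0

/-- `∫₀^∞ α = ∫₀^∞ φ(t) dt/t` for `α(y) = φ(1/|y|)/|y|` (the substitution `u ↦ 1/u`).
[cite: Burnol2001CRAS, §3 (TeX l.512–516: `φ̂(0) = ∫ φ(t) t⁻¹ dt`)] -/
theorem integral_Ioi_inv_abs (φ : ℝ → ℂ) :
    ∫ u in Ioi (0 : ℝ), CoPoisson.inv (fun v : ℝ ↦ φ |v|) u = ∫ t in Ioi (0 : ℝ), φ t / (t : ℂ) := by
  have h := integral_comp_rpow_Ioi (fun v : ℝ ↦ φ v / (v : ℂ)) (p := -1) (by norm_num)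
  rw [← h]
  refine setIntegral_congr_fun measurableSet_Ioi fun x hx ↦ ?_
  have hx0 : (0 : ℝ) < x := hx
  simp only [Real.rpow_neg_one, CoPoisson.inv]
  have hx2 : x ^ ((-1 : ℝ) - 1) = (x ^ 2)⁻¹ := by
    rw [show ((-1 : ℝ) - 1) = -2 by norm_num, Real.rpow_neg hx0.le, Real.rpow_two]
  rw [hx2, abs_neg, abs_one, one_mul, Complex.real_smul, abs_inv, abs_of_pos hx0]
  have hxC : (x : ℂ) ≠ 0 := by exact_mod_cast hx0.ne'
  push_cast
  field_simp

/-- `∫₀^∞ α(u) du/u = ∫₀^∞ φ` for `α(y) = φ(1/|y|)/|y|` (the substitution `u ↦ 1/u`).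
[cite: Burnol2001CRAS, §3 (TeX l.512–516: `φ̂(1) = ∫ φ`)] -/
theorem integral_Ioi_inv_abs_div (φ : ℝ → ℂ) :
    ∫ u in Ioi (0 : ℝ), CoPoisson.inv (fun v : ℝ ↦ φ |v|) u / (u : ℂ) = ∫ t in Ioi (0 : ℝ), φ t := by
  have h := integral_comp_rpow_Ioi (fun v : ℝ ↦ φ v) (p := -1) (by norm_num)
  rw [← h]
  refine setIntegral_congr_fun measurableSet_Ioi fun x hx ↦ ?_
  have hx0 : (0 : ℝ) < x := hx
  simp only [Real.rpow_neg_one, CoPoisson.inv]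
  have hx2 : x ^ ((-1 : ℝ) - 1) = (x ^ 2)⁻¹ := by
    rw [show ((-1 : ℝ) - 1) = -2 by norm_num, Real.rpow_neg hx0.le, Real.rpow_two]
  rw [hx2, abs_neg, abs_one, one_mul, Complex.real_smul, abs_inv, abs_of_pos hx0]
  have hxC : (x : ℂ) ≠ 0 := by exact_mod_cast hx0.ne'
  push_cast
  field_simp

/-- **The co-Poisson identity `I(P'(α))(t) = E(φ)(t)`** for `t ≠ 0`, `α = I(φ ∘ |·|)`, when `∫₀^∞ φ = 0`
(so that `E(φ)(u) = Σ_{n≥1} φ(n|u|)` and `∫₀^∞ α(u)du/u = 0`): `P'(α)(1/t)/|t| = Σ_{n≥1} φ(n|t|)`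
(Burnol 2004's `P' = I P I` specialised; "formule de Poisson pour `I(E(φ))`", TeX l.531).
[cite: Burnol2001CRAS, Thm 3.1 proof (TeX l.528–533); Burnol2004, §4 (TeX l.1300–1310)] -/
theorem coSum_inv_abs_div_eq_poissonE (h0 : ∫ t in Ioi (0 : ℝ), φ t = 0) {t : ℝ} (ht : t ≠ 0) :
    CoPoisson.coSum (CoPoisson.inv (fun v : ℝ ↦ φ |v|)) t⁻¹ / ((|t| : ℝ) : ℂ) = poissonE φ t := by
  have htabs : 0 < |t| := abs_pos.2 ht
  have htC : ((|t| : ℝ) : ℂ) ≠ 0 := by exact_mod_cast htabs.ne'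
  rw [CoPoisson.coSum, integral_Ioi_inv_abs_div, h0, sub_zero, poissonE, h0, zero_div, sub_zero]
  have hterm : ∀ n : ℕ, CoPoisson.inv (fun v : ℝ ↦ φ |v|) (t⁻¹ / ((n : ℝ) + 1)) / ((n : ℂ) + 1) =
      ((|t| : ℝ) : ℂ) * φ (((n : ℝ) + 1) * |t|) := by
    intro n
    have hn : (0 : ℝ) < (n : ℝ) + 1 := by positivity
    have hnC : ((n : ℂ) + 1) ≠ 0 := by exact_mod_cast hn.ne'
    simp only [CoPoisson.inv]
    have e1 : |(t⁻¹ / ((n : ℝ) + 1))⁻¹| = ((n : ℝ) + 1) * |t| := by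
      rw [inv_div, abs_div, abs_inv, abs_of_pos hn, div_inv_eq_mul]
    have e2 : (|t⁻¹ / ((n : ℝ) + 1)| : ℝ) = |t|⁻¹ / ((n : ℝ) + 1) := by
      rw [abs_div, abs_inv, abs_of_pos hn]
    rw [e1, e2]
    push_cast
    field_simp
  simp_rw [hterm]
  rw [tsum_mul_left, mul_div_cancel_left₀ _ htC]

/-- **`E(φ) ∈ H_Λ` for `φ ∈ D(𝒱_Λ)`** (`Λ > 0`): there is an `L²` class a.e. equal to `E(φ)`, and it lies in
`H_Λ`. Construction: `α = I(φ ∘ |·|)` is a test function supported in `1/Λ ≤ |y| ≤ Λ` with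
`∫₀^∞ α = φ̂(0) = 0` and `∫₀^∞ α(u)du/u = φ̂(1) = 0`, so the co-Poisson sum `P'(α)` is a Sonine function
of `K_{1/Λ}` (Burnol 2004 §6, tree theorem `CoPoisson.IsTestAway.toLp_coSum_mem_sonineK`); its inversion
`I P'(α) = E(φ)` then lies in `I K_{1/Λ} = H_Λ`.
[cite: Burnol2001CRAS, Thm 3.1 proof (TeX l.528–533); Burnol2004, §6 (TeX l.2190–2203)] -/
theorem exists_memHLambda_ae_eq_poissonE (hΛ : 0 < Λ) (hφ : MemDVLambda Λ φ) :
    ∃ F : Lp ℂ 2 (volume : Measure ℝ), (∀ᵐ u : ℝ, F u = poissonE φ u) ∧ memHLambda Λ F := by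
  obtain ⟨hV, hφ0, hφ1⟩ := hφ
  set α : ℝ → ℂ := CoPoisson.inv (fun v : ℝ ↦ φ |v|) with hα_def
  have hα : CoPoisson.IsTestAway α := isTestAway_inv_abs hΛ hV
  have hz : ∀ y : ℝ, |y| < Λ⁻¹ → α y = 0 := fun y hy ↦ inv_abs_eq_zero_of_abs_lt hΛ hV hy
  have hz' : ∀ y : ℝ, Λ⁻¹⁻¹ < |y| → α y = 0 := fun y hy ↦ inv_abs_eq_zero_of_lt_abs hΛ hV hy
  have h0 : ∫ u in Ioi (0 : ℝ), α u = 0 := by rw [hα_def, integral_Ioi_inv_abs, hφ0]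
  have h1 : ∫ u in Ioi (0 : ℝ), α u / (u : ℂ) = 0 := by rw [hα_def, integral_Ioi_inv_abs_div, hφ1]
  set k : Lp ℂ 2 (volume : Measure ℝ) := hα.memLp_two_coSum.toLp (CoPoisson.coSum α) with hk_def
  have hk : k ∈ sonineK Λ⁻¹ := hα.toLp_coSum_mem_sonineK (inv_pos.2 hΛ) hz hz' h0 h1
  have hkae : ∀ᵐ t : ℝ, (k : ℝ → ℂ) t = CoPoisson.coSum α t := hα.memLp_two_coSum.coeFn_toLp
  refine ⟨(memLp_invT k).toLp (fun t : ℝ ↦ (k : ℝ → ℂ) t⁻¹ / ((|t| : ℝ) : ℂ)), ?_, ?_⟩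
  · have hkae' := quasiMeasurePreserving_invReal.ae hkae
    filter_upwards [(memLp_invT k).coeFn_toLp, hkae', ae_ne_zero_real] with t h1' h2' ht0
    rw [h1', h2', hα_def, coSum_inv_abs_div_eq_poissonE hφ1 ht0]
  · have h := memHLambda_toLp_invT_of_mem_sonineK (inv_pos.2 hΛ) hk
    rwa [inv_inv] at h

/-- **Burnol 2001 (CRAS), Théorème 3.1, first clause — `W_Λ ⊆ H_Λ`** (for every `Λ > 0`; the Note states it
for `Λ > 1`, the only case where `D(𝒱_Λ) ≠ {0}`): every element of the closure `W_Λ` of the classes of the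
`E(φ)`, `φ ∈ D(𝒱_Λ)`, satisfies `memHLambda Λ` — each generator does (`exists_memHLambda_ae_eq_poissonE`)
and `H_Λ` is closed (`isClosed_setOf_memHLambda`).
[cite: Burnol2001CRAS, Théorème 3.1 (TeX l.522–533)] -/
theorem crasW_subset_memHLambda (hΛ : 0 < Λ) :
    ∀ F : Lp ℂ 2 (volume : Measure ℝ), F ∈ crasW Λ → memHLambda Λ F := by
  intro F hF
  have hsub : {F : Lp ℂ 2 (volume : Measure ℝ) |
      ∃ φ : ℝ → ℂ, MemDVLambda Λ φ ∧ ∀ᵐ u : ℝ, F u = poissonE φ u} ⊆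
      {F : Lp ℂ 2 (volume : Measure ℝ) | memHLambda Λ F} := by
    rintro G ⟨φ, hφ, hG⟩
    obtain ⟨F', hF', hmem⟩ := exists_memHLambda_ae_eq_poissonE hΛ hφ
    have : G = F' := by
      apply Lp.ext
      filter_upwards [hG, hF'] with u h1 h2
      rw [h1, h2]
    rw [Set.mem_setOf_eq, this]
    exact hmem
  exact (isClosed_setOf_memHLambda Λ).closure_subset_iff.2 hsub hF

end CoPoisson

end Burnol2001

end Literature.Analysis.DeBrangesSpaces
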